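import Summits.BirchSwinnertonDyer.Rank1Residual.GaloisImage.KuriharaLowerBoundThreeOfTransport
import Summits.BirchSwinnertonDyer.Rank1Residual.GaloisImage.KolyvaginPrimeFrobeniusClass
import Literature.NumberTheory.EllipticCurves.KatoKolyvaginPrimes
import Literature.NumberTheory.EllipticCurves.ModularityVersionApProofs
import Literature.NumberTheory.EllipticCurves.BSDConductorProofs
import HarnessLib

/-!
# (C20) at `p = 3` in Kim's ℕ-currency: a Kurihara certificate at a square-free product of
# Kolyvagin primes (bridge B1 assembled; team n1011, ROUTE-1 R1-23 / R23_endshape; seat p18)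

HONEST FRAMING (cell `b2b-bsdres`, verbatim in every file): the goal of the cell is to DELETE the
COMBINATION-SHAPED residual classes of the Birch–Swinnerton-Dyer formula for ALL analytic-rank
`≤ 1` elliptic curves over `ℚ` — assembled STRICTLY from published theorems — so that the
rank-`≤ 1` remainder becomes exactly the CONSTRUCTION-SHAPED classes, which are TYPED, NOT
attempted. This is not "finishing BSD". Team n1011 (N10/N11, additive `X4 ∧ p = 3`): research
route; the END THEOREM of sub-route (a′) modulo NAMED typed inputs carried as explicit hypotheses
(nothing asserted). No class theorem is claimed; nothing is booked; no mark moves.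

## What and why

`Assembly.padicValRat_le_of_certificate_of_transport` takes its certificate at a Finset-level of
the shallow datum `D`.  R23_endshape (planner r1) speaks Kim's currency: `n ∈ 𝒩_{k+1}`
(`Kato.IsKolyvaginProduct W 3 (k+1) n`: square-free, `ℓ ∤ 3N_E`, `ℓ ≡ 1`, `a_ℓ ≡ ℓ + 1
(mod 3^{k+1})`), the cyclicity flag at the primes of `n`, ONE choice `ψ` of discrete logarithms,
`δ̃^{(j)}_n(ψ) ≠ 0` and `δ̃^{(j)}_d(ψ) = 0` for the proper divisors `1 < d < n`.  This file is
the bridge (B1):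

* `FrobShape.exists_level_of_kolyvaginProduct` — for `D.primes = frobeniusClassPrimes ρ S τ 3^K`
  (`τ` of shape (H.2) fixing `μ_{3^K}`, `ρ_{E,3^K}` onto), the places of `n` form a level `nF`
  of `D` with `∏_{q ∈ nF} N q = n` (`mem_frobeniusClassPrimes_of_kolyvaginPrime'` prime by prime);
* `Assembly.padicValRat_le_of_kolyvaginProduct` — the END THEOREM with the certificate in Kim's
  currency; the sub-level hypothesis passes from the fixed `ψ` to every surjective `ψ′` by
  `exists_units_kuriharaNumber_eq_mul` (`δ̃_n` is well defined up to a unit, [K22] §1.4.3).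

Binders beyond R23_endshape's, all visible: the typed inputs of `…_of_transport` (dictionary PORT,
[S24] (1)(2) instances at every level, Poitou–Tate families, `hEP`, datum shape), the τ-datum
`hDP`/`hτμ`/`hτq`, `ρ_{E,3^{k+1}}` onto (R23 assumes the whole tower), the flag in the currency of
the reduction `W.reductionAt v` of the local minimal model (R23: the global minimal model reduced
mod `ℓ`; the two are isomorphic, Silverman VII.1.3(b) — adapter (M), not in this file), and
`∀ ℓ ∣ n, ℓ ∤ N` for the level `N` of the parametrisation (`= N_E` only under the named fact
`IsNewformOf.level_eq_conductorNorm`, which R23 does not carry).  (B6) (verbatim): on `t = 1`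
rows supply `D ⊆ 𝒫_{k+1+t}`, `D′ ⊆ 𝒫_{k′+1+t}`; the [S24]-side inputs are then S24-DEEP (R1-35).

References: C.-H. Kim, AJM 148 (2026) §1.2.2, §1.4.3, Thm. 1.9 [Kim2022StructureSelmer];
R. Sakamoto, Math. Ann. (2024) §2 [Sakamoto2024]; J. H. Silverman, *AEC* VII.1.3(b), VII.3.1(b)
[SilvermanAEC2009].
-/

noncomputable section

open scoped Classical NumberField ContRepresentation
open Function Field NumberField IsDedekindDomain IsDedekindDomain.HeightOneSpectrum WeierstrassCurve
  Literature.NumberTheory.EllipticCurves Literature.NumberTheory.EllipticCurves.ModularForms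
  Literature.NumberTheory.EllipticCurves.Rank1Residual
  Literature.NumberTheory.GaloisRepresentations
  Literature.NumberTheory.GaloisRepresentations.DiscreteGaloisModule Literature.NumberTheory.GaloisCohomology

namespace Summit.BirchSwinnertonDyer.Rank1Residual.GaloisImage

namespace FrobShape

/-- **The places of a Kolyvagin product form a level of the `τ`-datum.**  For `n ∈ 𝒩_K` (Kim:
square-free product of primes `ℓ ∤ pN_E`, `ℓ ≡ 1`, `a_ℓ ≡ ℓ + 1 (mod p^K)`) whose primes satisfy
the cyclicity flag `#Ẽ_v(k_v)[p] ≤ p`, `ρ_{E,p^K}` onto and `τ ∈ Γ_{ℚ(μ_{p^K})}` with (H.2):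
the set `nF` of places of `n` lies in `frobeniusClassPrimes ρ S τ (p^K)` (any `S` avoiding them),
`∏_{q ∈ nF} N q = n`, and every `N q` (`q ∈ nF`) is a prime factor of `n`.
[cite: Kim2022StructureSelmer, §1.2.2] [cite: Sakamoto2024, §2 (pp. 920–921)] -/
theorem exists_level_of_kolyvaginProduct (W : WeierstrassCurve ℚ) [W.IsElliptic]
    [W.IsGloballyMinimal] (p : ℕ) [Fact p.Prime] {K : ℕ} (hK : 0 < K) {n : ℕ}
    (hn : Kato.IsKolyvaginProduct W p K n)
    (hflag : ∀ v : HeightOneSpectrum (𝓞 ℚ), Ideal.absNorm v.asIdeal ∣ n →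
      Nat.card (AddSubgroup.torsionBy (W.reductionAt v).toAffine.Point (p : ℕ)) ≤ p)
    (m : ℤ) (hm : m = ((p ^ K : ℕ) : ℤ)) (hsurj : W.HasSurjectiveModNGaloisRep m)
    {τ : absoluteGaloisGroup ℚ} (hτμ : τ ∈ rootsOfUnityFixer ℚ (p ^ K))
    (hτq : Nonempty (cokerSubOne (W.torsionGaloisModule m) τ ≃+ ZMod (p ^ K)))
    {S : Set (HeightOneSpectrum (𝓞 ℚ))} (hS : ∀ v : HeightOneSpectrum (𝓞 ℚ),
      Ideal.absNorm v.asIdeal ∣ n → v ∉ S) :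
    ∃ nF : Finset (HeightOneSpectrum (𝓞 ℚ)),
      (↑nF ⊆ frobeniusClassPrimes (W.torsionGaloisModule m) S τ (p ^ K)) ∧
      (∏ q ∈ nF, Ideal.absNorm q.asIdeal = n) ∧
      ∀ q ∈ nF, Ideal.absNorm q.asIdeal ∈ n.primeFactors := by
  classical
  -- the place of a rational prime
  let place : ℕ → HeightOneSpectrum (𝓞 ℚ) := fun ℓ =>
    if h : ℓ.Prime then (Rat.HeightOneSpectrum.primesEquiv (R := 𝓞 ℚ)).symm ⟨ℓ, h⟩
    else (Rat.HeightOneSpectrum.primesEquiv (R := 𝓞 ℚ)).symm ⟨2, Nat.prime_two⟩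
  have hplace : ∀ ℓ, ℓ.Prime → (ℓ : 𝓞 ℚ) ∈ (place ℓ).asIdeal := fun ℓ hℓ => by
    simp only [place, dif_pos hℓ]
    exact (natCast_mem_asIdeal_iff_eq_primesEquiv_symm _ hℓ).mpr rfl
  have habs : ∀ ℓ, ℓ.Prime → Ideal.absNorm (place ℓ).asIdeal = ℓ := fun ℓ hℓ => by
    change (place ℓ).residueCard = ℓ
    exact residueCard_eq_of_natCast_mem hℓ (hplace ℓ hℓ)
  refine ⟨n.primeFactors.image place, ?_, ?_, ?_⟩
  · -- every place of `n` is a Frobenius-class prime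
    intro q hq
    rw [Finset.coe_image] at hq
    obtain ⟨ℓ, hℓ, rfl⟩ := hq
    have hℓn := Nat.mem_primeFactors.mp (Finset.mem_coe.mp hℓ)
    have hℓK : Kato.IsKolyvaginPrime W p K ℓ := hn.isKolyvaginPrime hℓn.1 hℓn.2.1
    haveI : Fact ℓ.Prime := ⟨hℓn.1⟩
    have hgood : W.HasGoodReductionAtPrime ℓ := by
      by_contra h
      exact hℓK.not_dvd_conductorNorm ((W.dvd_conductorNorm_iff_not_hasGoodReductionAtPrime ℓ).mpr h)
    have hdvd : Ideal.absNorm (place ℓ).asIdeal ∣ n := by rw [habs ℓ hℓn.1]; exact hℓn.2.1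
    exact mem_frobeniusClassPrimes_of_kolyvaginPrime' W p ℓ hℓK.ne hgood (hplace ℓ hℓn.1) hK
      hℓK.modEq_one (hflag _ hdvd) hℓK.pow_dvd_reductionPointCount m hm hsurj hτμ hτq (hS _ hdvd)
  · -- `∏ N q = ∏ ℓ = n`
    rw [Finset.prod_image]
    · conv_rhs => rw [← Nat.prod_primeFactors_of_squarefree hn.squarefree]
      exact Finset.prod_congr rfl fun ℓ hℓ => habs ℓ (Nat.prime_of_mem_primeFactors hℓ)
    · intro ℓ hℓ ℓ' hℓ' h
      rw [← habs ℓ (Nat.prime_of_mem_primeFactors hℓ), ← habs ℓ' (Nat.prime_of_mem_primeFactors hℓ'),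
        h]
  · intro q hq
    obtain ⟨ℓ, hℓ, rfl⟩ := Finset.mem_image.mp hq
    rw [habs ℓ (Nat.prime_of_mem_primeFactors hℓ)]
    exact hℓ

end FrobShape

namespace Assembly

/-- Changing the level along an equality of natural numbers does not change a Kurihara number
(the `NeZero` instances are propositionally irrelevant). [folklore] -/
theorem kuriharaNumber_congr_level {N : ℕ} (f : CuspForm (CongruenceSubgroup.Gamma0 N) 2) (m : ℕ)
    {a b : ℕ} (h : a = b) (ia : NeZero a) (ib : NeZero b)
    (ψ : (ℓ : ℕ) → (ZMod ℓ)ˣ →* Multiplicative (ZMod m)) :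
    @kuriharaNumber N f m a ia ψ = @kuriharaNumber N f m b ib ψ := by
  subst h
  congr

/-- **(C20) at `p = 3` in Kim's ℕ-currency — R23_endshape's conclusion from a certificate at a
square-free product `n` of Kolyvagin primes** (module docstring).  Beyond the typed inputs of
`padicValRat_le_of_certificate_of_transport`: the shallow datum is a `τ`-datum
(`D.primes = frobeniusClassPrimes ρ S τ 3^{k+1}`, `τ ∈ Γ_{ℚ(μ)}` with (H.2)), `ρ_{E,3^{k+1}}` is
onto, `n ∈ 𝒩_{k+1}` (Kim) with the cyclicity flag at its primes (reduction of the local minimal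
model) and `ℓ ∤ N` for `ℓ ∣ n`, ONE system `ψ` of surjective discrete logarithms, `δ̃^{(j)}_n(ψ) ≠ 0`
and `δ̃^{(j)}_d(ψ) = 0` for `1 < d < n`, `d ∣ n`.  (B6): on `t = 1` rows supply
`D ⊆ 𝒫_{k+1+t}`, `D′ ⊆ 𝒫_{k′+1+t}`.
[cite: Kim2022StructureSelmer, Thm. 1.9 (6), §1.2.2 and §1.4.3] [cite: Sakamoto2024, §2 and Thm. 4.4]
[cite: MazurRubin2004, Thm. 3.2.4, Thm. 4.4.1 and App. A (33)] -/
theorem padicValRat_le_of_kolyvaginProduct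
    (W : WeierstrassCurve ℚ) [W.IsElliptic] [W.IsGloballyMinimal] (t k : ℕ)
    (D : KolyvaginDatum (W.torsionGaloisModule (((3 : ℕ) : ℤ) ^ k * ((3 : ℕ) : ℤ))))
    (v₃ : HeightOneSpectrum (𝓞 ℚ)) (hv₃ : ((3 : ℕ) : 𝓞 ℚ) ∈ v₃.asIdeal)
    -- the row
    (hadd : Addv W 3) (hc3 : ¬ 3 ∣ (W.baseChange ℚ_[3]).localTamagawaNumber ℤ_[3])
    (hsurj : W.HasSurjectiveModNGaloisRep ((3 : ℕ) : ℤ))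
    (ht : Nat.card {Q : (W.baseChange ℚ_[3]).toAffine.Point // (3 : ℕ) • Q = 0} = 3 ^ t)
    (hL : W.entireLFunction 1 ≠ 0) [Finite W.toAffine.Point] [Finite W.sha]
    {N : ℕ} [NeZero N] (P : ModularParametrizationData W N) (hcP : ¬ ((3 : ℕ) : ℤ) ∣ P.maninConstant)
    (hper : ∃ u : ℚ, ‖(u : ℚ_[3])‖ = 1 ∧ W.realPeriodRat = u * plusPeriod P.f)
    -- the shallow datum: cyclotomic transverse condition, a generator `g` of `KS₁`, and Sakamoto's
    -- Thm. 4.4 (2) in ORDER form at every level (R1-22 instance)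
    (hDT : D.transverse = cyclotomicTransverse _)
    (g : Finset (HeightOneSpectrum (𝓞 ℚ)) →
      galoisCohomology (W.torsionGaloisModule (((3 : ℕ) : ℤ) ^ k * ((3 : ℕ) : ℤ))) 1)
    (hg : g ∈ D.kolyvaginSystems (propagatedSelmerStructure W 3 k))
    (hgen : ∀ κ ∈ D.kolyvaginSystems (propagatedSelmerStructure W 3 k), ∃ a : ℕ, κ = a • g)
    -- the deep inputs, at every depth `k′`
    (D' : ∀ k' : ℕ, KolyvaginDatum (W.torsionGaloisModule (((3 : ℕ) : ℤ) ^ k' * ((3 : ℕ) : ℤ))))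
    (hDT' : ∀ k', (D' k').transverse = cyclotomicTransverse _)
    (hPP' : ∀ k', (D' k').primes ⊆ D.primes)
    (red : ∀ k' : ℕ, (W.torsionGaloisModule (((3 : ℕ) : ℤ) ^ k' * ((3 : ℕ) : ℤ))).toContRepresentation
      →ⁱL (W.torsionGaloisModule (((3 : ℕ) : ℤ) ^ k * ((3 : ℕ) : ℤ))).toContRepresentation)
    (hred : ∀ k', ∀ x : geomTorsion W (((3 : ℕ) : ℤ) ^ k' * ((3 : ℕ) : ℤ)),
      ((red k' x : geomTorsion W (((3 : ℕ) : ℤ) ^ k * ((3 : ℕ) : ℤ))) : geomPoints W) =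
        (((3 : ℕ) : ℤ) ^ (k' - k)) • (x : geomPoints W))
    (hdict : ∀ k', k ≤ k' → KatoKuriharaDictionaryThreeAt₂ W t k k' D (D' k') (red k') v₃)
    (g' : ∀ k' : ℕ, Finset (HeightOneSpectrum (𝓞 ℚ)) →
      galoisCohomology (W.torsionGaloisModule (((3 : ℕ) : ℤ) ^ k' * ((3 : ℕ) : ℤ))) 1)
    (hg' : ∀ k', g' k' ∈ (D' k').kolyvaginSystems (propagatedSelmerStructure W 3 k'))
    (hgo' : ∀ k', addOrderOf (g' k') = 3 ^ (k' + 1))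
    (hgen' : ∀ k', ∀ κ ∈ (D' k').kolyvaginSystems (propagatedSelmerStructure W 3 k'),
      ∃ a : ℕ, κ = a • g' k')
    (inv' : ∀ k' : ℕ, LocalInvariants ℚ (3 ^ (k' + 1))) (hperf' : ∀ k', (inv' k').IsPerfect)
    (hsum' : ∀ k', (inv' k').SumLocalTermEqZero) (hcompl' : ∀ k', (inv' k').SelmerComplement)
    (hinj' : ∀ k', ∀ v : HeightOneSpectrum (𝓞 ℚ), Injective (inv' k' (Sum.inr v)))
    (hEP : ∀ v : HeightOneSpectrum (𝓞 ℚ), localEulerPoincareCharacteristic (v.adicCompletion ℚ))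
    (T : ∀ k' : ℕ, Finset (HeightOneSpectrum (𝓞 ℚ))) (hv₃T : ∀ k', v₃ ∈ T k')
    (hT : ∀ k', ∀ v : HeightOneSpectrum (𝓞 ℚ), v ∉ T k' →
      (((3 ^ (k' + 1) : ℕ) : ℕ) : 𝓞 ℚ) ∉ v.asIdeal ∧
        GaloisRep.IsUnramifiedAt v (W.torsionGaloisModule (((3 : ℕ) : ℤ) ^ k' * ((3 : ℕ) : ℤ))))
    (h𝓕T : ∀ k', (propagatedSelmerStructure W 3 k').IsUnramifiedOutside (finSupport (T k')))
    (h𝓚T : ∀ k', (W.kummerSelmerStructure (((3 : ℕ) : ℤ) ^ k' * ((3 : ℕ) : ℤ))).IsUnramifiedOutside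
      (finSupport (T k')))
    (hfinT : ∀ k', Finite (geomTorsion W (((3 : ℕ) : ℤ) ^ k' * ((3 : ℕ) : ℤ))))
    (hfinS : ∀ k', Finite (W.kummerSelmerStructure (((3 : ℕ) : ℤ) ^ k' * ((3 : ℕ) : ℤ))).selmerGroup)
    -- the primes of the data lie off the admissible sets and have Rubin's local shape
    (hPS : ∀ q ∈ D.primes, q ∉ T k) (hPS' : ∀ k', ∀ q ∈ (D' k').primes, q ∉ T k')
    (hUT : ∀ q ∈ D.primes,
      Nat.card (unramifiedSubgroup (GaloisRep.toLocal q
        (W.torsionGaloisModule (((3 : ℕ) : ℤ) ^ k * ((3 : ℕ) : ℤ)))) 1) =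
        Nat.card (D.transverse (Sum.inr q)))
    (hUT' : ∀ k', ∀ q ∈ (D' k').primes,
      Nat.card (unramifiedSubgroup (GaloisRep.toLocal q
        (W.torsionGaloisModule (((3 : ℕ) : ℤ) ^ k' * ((3 : ℕ) : ℤ)))) 1) =
        Nat.card ((D' k').transverse (Sum.inr q)))
    -- Sakamoto's Thm. 4.4 (2) in ORDER form at every level, shallow and deep (R1-22 / S24-DEEP)
    (hR22D : ∀ d, D.IsLevel d →
      (Nat.card ((inv' k).dualSelmerStructure _
          (D.atLevel (propagatedSelmerStructure W 3 k) d)).selmerGroup ∣ 3 ^ (k + 1) →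
        addOrderOf (g d) * Nat.card ((inv' k).dualSelmerStructure _
          (D.atLevel (propagatedSelmerStructure W 3 k) d)).selmerGroup = 3 ^ (k + 1)) ∧
      (3 ^ (k + 1) ∣ Nat.card ((inv' k).dualSelmerStructure _
          (D.atLevel (propagatedSelmerStructure W 3 k) d)).selmerGroup → g d = 0))
    (hR22' : ∀ k' d, (D' k').IsLevel d →
      (Nat.card ((inv' k').dualSelmerStructure _
          ((D' k').atLevel (propagatedSelmerStructure W 3 k') d)).selmerGroup ∣ 3 ^ (k' + 1) →
        addOrderOf (g' k' d) * Nat.card ((inv' k').dualSelmerStructure _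
          ((D' k').atLevel (propagatedSelmerStructure W 3 k') d)).selmerGroup = 3 ^ (k' + 1)) ∧
      (3 ^ (k' + 1) ∣ Nat.card ((inv' k').dualSelmerStructure _
          ((D' k').atLevel (propagatedSelmerStructure W 3 k') d)).selmerGroup → g' k' d = 0))
    -- the shallow datum is a `τ`-datum at level `3^{k+1}`, and `ρ_{E,3^{k+1}}` is onto
    {S : Set (HeightOneSpectrum (𝓞 ℚ))} {τ : absoluteGaloisGroup ℚ}
    (hτμ : τ ∈ rootsOfUnityFixer ℚ (3 ^ (k + 1)))
    (hτq : Nonempty (cokerSubOne (W.torsionGaloisModule (((3 : ℕ) : ℤ) ^ k * ((3 : ℕ) : ℤ))) τ ≃+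
      ZMod (3 ^ (k + 1))))
    (hDP : D.primes = frobeniusClassPrimes
      (W.torsionGaloisModule (((3 : ℕ) : ℤ) ^ k * ((3 : ℕ) : ℤ))) S τ (3 ^ (k + 1)))
    (hsurjK : W.HasSurjectiveModNGaloisRep (((3 : ℕ) : ℤ) ^ k * ((3 : ℕ) : ℤ)))
    -- the certificate in Kim's currency
    (n : ℕ) [NeZero n] (hn : Kato.IsKolyvaginProduct W 3 (k + 1) n)
    (hflag : ∀ v : HeightOneSpectrum (𝓞 ℚ), Ideal.absNorm v.asIdeal ∣ n →
      Nat.card (AddSubgroup.torsionBy (W.reductionAt v).toAffine.Point (3 : ℕ)) ≤ 3)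
    (hnS : ∀ v : HeightOneSpectrum (𝓞 ℚ), Ideal.absNorm v.asIdeal ∣ n → v ∉ S)
    (hnN : ∀ ℓ ∈ n.primeFactors, ¬ ℓ ∣ N) {j : ℕ} (htj : t + j ≤ k + 1)
    (ψ : (ℓ : ℕ) → (ZMod ℓ)ˣ →* Multiplicative (ZMod (3 ^ j)))
    (hψ : ∀ ℓ ∈ n.primeFactors, Function.Surjective (ψ ℓ))
    (hcert : kuriharaNumber P.f (3 ^ j) n ψ ≠ 0)
    (hv : ∀ d : ℕ, d ∣ n → 1 < d → d < n → ∀ [NeZero d], kuriharaNumber P.f (3 ^ j) d ψ = 0) :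
    ∃ q : ℚ, W.entireLFunction 1 / (W.realPeriodRat : ℂ) = (q : ℂ) ∧
      padicValRat 3 q ≤
        (padicValNat 3 (Nat.card (AddCommGroup.primaryComponent W.sha 3)) : ℤ) + ((j - 1 : ℕ) : ℤ) := by
  haveI : Fact (Nat.Prime 3) := ⟨Nat.prime_three⟩
  -- the places of `n` form a level of `D`
  obtain ⟨nF, hsub, hprod, hmem⟩ := FrobShape.exists_level_of_kolyvaginProduct W 3
    (Nat.succ_pos k) hn hflag (((3 : ℕ) : ℤ) ^ k * ((3 : ℕ) : ℤ)) (by push_cast; rw [pow_succ]) hsurjK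
    hτμ hτq hnS
  have hlev : D.IsLevel nF := by
    change (↑nF : Set _) ⊆ D.primes
    rw [hDP]
    exact hsub
  have hprime : ∀ q ∈ nF, (Ideal.absNorm q.asIdeal).Prime := fun q hq =>
    Nat.prime_of_mem_primeFactors (hmem q hq)
  have hinj := absNorm_injOn (↑nF : Set (HeightOneSpectrum (𝓞 ℚ)))
  have hn0 : n ≠ 0 := hn.ne_zero
  -- sub-products are divisors of `n`
  have hdvd : ∀ c ⊆ nF, (∏ q ∈ c, Ideal.absNorm q.asIdeal) ∣ n := fun c hc => by
    rw [← hprod]; exact Finset.prod_dvd_prod_of_subset _ _ _ hc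
  refine padicValRat_le_of_certificate_of_transport W t k D v₃ hv₃ hadd hc3 hsurj ht hL P hcP hper
    hDT g hg hgen D' hDT' hPP' red hred hdict g' hg' hgo' hgen' inv' hperf' hsum' hcompl' hinj' hEP
    T hv₃T hT h𝓕T h𝓚T hfinT hfinS hPS hPS' hUT hUT' hR22D hR22' nF hlev htj ?_ (ψ₀ := ψ) ?_ ?_ ?_
  · -- `N q ∤ N`
    intro q hq
    exact (Nat.Prime.coprime_iff_not_dvd (hprime q hq)).mpr (hnN _ (hmem q hq))
  · exact fun q hq => hψ _ (hmem q hq)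
  · -- the certificate at `n = ∏ N q`
    rw [kuriharaNumber_congr_level P.f (3 ^ j) hprod _ inferInstance ψ]
    exact hcert
  · -- the proper non-empty sub-levels: proper divisors `1 < d < n`, any surjective `ψ′`
    intro c hc hne ψ' hψ'
    set d := ∏ q ∈ c, Ideal.absNorm q.asIdeal with hd
    have hd0 : d ≠ 0 := Finset.prod_ne_zero_iff.2 fun q _ => absNorm_ne_zero q
    haveI : NeZero d := ⟨hd0⟩
    have hdn : d ∣ n := hdvd c hc.subset
    have h1d : 1 < d := by
      obtain ⟨q₀, hq₀⟩ := hne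
      have hle : Ideal.absNorm q₀.asIdeal ≤ d :=
        Nat.le_of_dvd (Nat.pos_of_ne_zero hd0) (Finset.dvd_prod_of_mem _ hq₀)
      exact lt_of_lt_of_le (hprime q₀ (hc.subset hq₀)).one_lt hle
    have hdlt : d < n := by
      have hsd : (nF \ c).Nonempty := Finset.sdiff_nonempty.mpr hc.not_subset
      obtain ⟨q₁, hq₁⟩ := hsd
      have hsplit := Finset.prod_sdiff (f := fun q => Ideal.absNorm q.asIdeal) hc.subset
      rw [hprod] at hsplit
      have h1 : 1 < ∏ q ∈ nF \ c, Ideal.absNorm q.asIdeal := by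
        have hle : Ideal.absNorm q₁.asIdeal ≤ ∏ q ∈ nF \ c, Ideal.absNorm q.asIdeal :=
          Nat.le_of_dvd (Nat.pos_of_ne_zero (Finset.prod_ne_zero_iff.2 fun q _ => absNorm_ne_zero q))
            (Finset.dvd_prod_of_mem _ hq₁)
        exact lt_of_lt_of_le (hprime q₁ (Finset.sdiff_subset hq₁)).one_lt hle
      calc d = 1 * d := (one_mul d).symm
        _ < (∏ q ∈ nF \ c, Ideal.absNorm q.asIdeal) * d := Nat.mul_lt_mul_of_pos_right h1
            (Nat.pos_of_ne_zero hd0)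
        _ = n := hsplit
    have hzero : kuriharaNumber P.f (3 ^ j) d ψ = 0 := hv d hdn h1d hdlt
    -- `δ̃_d(ψ′) = u · δ̃_d(ψ)` for a unit `u`
    have hψd : ∀ ℓ ∈ d.primeFactors, Function.Surjective (ψ ℓ) := fun ℓ hℓ =>
      hψ ℓ (Nat.primeFactors_mono hdn hn0 hℓ)
    have hψ'd : ∀ ℓ ∈ d.primeFactors, Function.Surjective (ψ' ℓ) :=
      Shallow.forall_primeFactors_of_forall_mem (fun q : HeightOneSpectrum (𝓞 ℚ) =>
        Ideal.absNorm q.asIdeal) c (fun q hq => hprime q (hc.subset hq)) (hinj.mono hc.subset) hψ'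
    obtain ⟨u, hu⟩ := exists_units_kuriharaNumber_eq_mul P.f (3 ^ j) d hψd hψ'd
    change kuriharaNumber P.f (3 ^ j) d ψ' = 0
    rw [hu, hzero, mul_zero]

end Assembly

end Summit.BirchSwinnertonDyer.Rank1Residual.GaloisImage

end
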